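import Literature.AlgebraicGeometry.Motives.GeneratingSectionsOfCocycle
import Literature.AlgebraicGeometry.Modules.RankOneCocycle
import HarnessLib

/-!
# The coefficients of global sections of a line bundle with chosen local generators

[cite: Hartshorne1977, Chapter II, proof of Theorem 7.1; Exercise 5.18 (d)]
[cite: GortzWedhorn2020, Proposition 11.15 and (11.7)]

Let `E` be an `𝒪_X`-module with a frame system `F` of constant rank `1`
(`Literature.AlgebraicGeometry.Modules.FrameSystem`, `F.rank x = 1`: a line bundle with chosen
local generators `b_x ∈ Γ(E, U_x)`, Hartshorne II Ex. 5.18), with transition cocycle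
`g_{xy} = F.cocycle.g x y` (`b_y = g_{xy} · b_x`, ★ `FrameSystem.map_gen_eq`), and let
`t : ι → Γ(E, X)` be global sections. The COEFFICIENT of `t_i` at `x` is the function
`coeffAt F h t i x = λ_x(t_i|_{U_x}) ∈ Γ(X, U_x)` with `t_i|_{U_x} = coeffAt · b_x`
(★ `FrameSystem.eq_coord_smul_gen`). We prove the transition rule
`coeffAt i x |_V = coeffAt i y |_V · g_{xy}` (`map_coeffAt_eq`) and package the coefficients as a
`GeneratingSections.CocycleSections ι F.U` datum (`CocycleSections.ofFrameSystem`, via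
`CocycleSections.ofCocycle` with the unit cocycle `g_{yx}`), so that
`GeneratingSections.ofCocycleSections` produces the morphism to `ℙ(ι)` defined by `(E, (t_i))`
wherever the non-vanishing loci `X_{coeffAt i x}` cover (Hartshorne II Thm. 7.1), and
`CocycleSections.comap` its restrictions / pull-backs.
-/

open CategoryTheory Opposite TopologicalSpace AlgebraicGeometry

universe u

noncomputable section

-- `TopCat.Presheaf`/`Scheme.Modules` are not reducible (as in Mathlib's `AlgebraicGeometry/Modules`).
set_option backward.isDefEq.respectTransparency false

namespace Literature.AlgebraicGeometry.Motives

namespace GeneratingSections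

open Literature.AlgebraicGeometry.Modules

variable {X : Scheme.{u}} {E : X.Modules} (F : FrameSystem E) (h : ∀ x, F.rank x = 1)
  {ι : Type} (t : ι → Γ(E, ⊤))

/-- **The coefficient of the global section `t_i` in the local generator at `x`**:
`coeffAt i x = λ_x(t_i|_{U_x}) ∈ Γ(X, U_x)`, so that `t_i|_{U_x} = coeffAt i x · b_x`
(Hartshorne II, proof of Thm. 7.1: "`s = f · s_0` on the trivialising open").
[cite: Hartshorne1977, II proof of Thm. 7.1] -/
def coeffAt (i : ι) (x : X) : Γ(X, F.U x) :=
  coord (F.frame x) (𝟙 (F.U x)) (E.presheaf.map (homOfLE le_top).op (t i)) (F.idx h x)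

/-- `t_i|_{U_x} = coeffAt i x · b_x`. [cite: Hartshorne1977, II proof of Thm. 7.1] -/
theorem map_top_eq_coeffAt_smul (i : ι) (x : X) :
    E.presheaf.map (homOfLE (le_top : F.U x ≤ ⊤)).op (t i) =
      coeffAt F h t i x • E.presheaf.map (𝟙 (F.U x)).op (basisSection (F.frame x) (F.idx h x)) :=
  F.eq_coord_smul_gen h (𝟙 (F.U x)) _

/-- The coefficient restricted to `V ≤ U_x` is the coordinate of `t_i|_V` in the frame at `x`.
[cite: Hartshorne1977, II proof of Thm. 7.1] -/
theorem map_coeffAt (i : ι) (x : X) {V : X.Opens} (hV : V ≤ F.U x) :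
    X.presheaf.map (homOfLE hV).op (coeffAt F h t i x) =
      coord (F.frame x) (homOfLE hV) (E.presheaf.map (homOfLE (le_top : V ≤ ⊤)).op (t i))
        (F.idx h x) := by
  rw [coeffAt, ← coord_map (F.frame x) (𝟙 (F.U x)) (homOfLE hV), ← CategoryTheory.comp_apply,
    ← Functor.map_comp]
  rfl

/-- `t_i|_V = coeffAt i x |_V · b_x|_V` for `V ≤ U_x`. [cite: Hartshorne1977, II proof of Thm. 7.1] -/
theorem map_top_eq_map_coeffAt_smul (i : ι) (x : X) {V : X.Opens} (hV : V ≤ F.U x) :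
    E.presheaf.map (homOfLE (le_top : V ≤ ⊤)).op (t i) =
      X.presheaf.map (homOfLE hV).op (coeffAt F h t i x) •
        E.presheaf.map (homOfLE hV).op (basisSection (F.frame x) (F.idx h x)) := by
  rw [map_coeffAt]
  exact F.eq_coord_smul_gen h (homOfLE hV) _

/-- **Transition rule for the coefficients**: `coeffAt i x |_V = coeffAt i y |_V · g_{xy}` on
`V ≤ U_x ∩ U_y` (from `b_y = g_{xy} b_x` and the uniqueness of coordinates; Hartshorne II, proof
of Thm. 7.1 / Ex. 5.18 (d)). [cite: Hartshorne1977, II proof of Thm. 7.1] -/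
theorem map_coeffAt_eq (i : ι) (x y : X) {V : X.Opens} (hx : V ≤ F.U x) (hy : V ≤ F.U y) :
    X.presheaf.map (homOfLE hx).op (coeffAt F h t i x) =
      X.presheaf.map (homOfLE hy).op (coeffAt F h t i y) * F.cocycle.g x y V hx hy := by
  classical
  have ht := map_top_eq_map_coeffAt_smul F h t i y hy
  rw [F.map_gen_eq h hx hy, smul_smul] at ht
  have hc := congr_arg (fun s => coord (F.frame x) (homOfLE hx) s (F.idx h x)) ht
  simp only at hc
  rw [coord_smul, coord_map_basisSection, if_pos rfl, mul_one] at hc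
  rw [map_coeffAt, hc]

namespace CocycleSections

/-- **The coefficients of global sections of a line bundle with local generators form a
`CocycleSections` datum** on the trivialising opens `U_x`: `coeffAt i y = g_{yx} · coeffAt i x`
on `U_x ∩ U_y` with `g_{yx}` a unit (Hartshorne II, proof of Thm. 7.1 / Ex. 5.18 (d)).
[cite: Hartshorne1977, II proof of Thm. 7.1] -/
def ofFrameSystem : CocycleSections ι F.U :=
  CocycleSections.ofCocycle (coeffAt F h t)
    (fun x y => F.cocycle.g y x (F.U x ⊓ F.U y) inf_le_right inf_le_left)
    (fun i x y => by
      rw [map_coeffAt_eq F h t i y x inf_le_right inf_le_left, mul_comm])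
    (fun x y => F.cocycle.isUnit_g y x _ inf_le_right inf_le_left)

/-- The coefficients of `ofFrameSystem` are the `coeffAt` (`rfl`).
[cite: Hartshorne1977, II proof of Thm. 7.1] -/
@[simp] theorem ofFrameSystem_coeff :
    (ofFrameSystem F h t).coeff = coeffAt F h t := rfl

end CocycleSections

/-! ### The intrinsic non-vanishing locus of a section -/

/-- The non-vanishing loci of the coefficients agree on overlaps:
`X_{coeffAt i x} ∩ U_y = X_{coeffAt i y} ∩ U_x`. [cite: Hartshorne1977, II proof of Thm. 7.1] -/
theorem basicOpen_coeffAt_inf (i : ι) (x y : X) :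
    X.basicOpen (coeffAt F h t i x) ⊓ F.U y = X.basicOpen (coeffAt F h t i y) ⊓ F.U x :=
  le_antisymm
    (le_inf ((CocycleSections.ofFrameSystem F h t).locus i x y)
      (inf_le_left.trans (X.basicOpen_le _)))
    (le_inf ((CocycleSections.ofFrameSystem F h t).locus i y x)
      (inf_le_left.trans (X.basicOpen_le _)))

/-- **The non-vanishing locus `X_{t_i}`** of the section `t_i` (the union of the `X_{coeffAt i x}`)
meets each trivialising open `U_x` in `X_{coeffAt i x}`: it is computed in any one local generator
(Hartshorne II, proof of Thm. 7.1: "`X_s` is well defined"). [cite: Hartshorne1977, II proof of Thm. 7.1] -/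
theorem iSup_basicOpen_coeffAt_inf (i : ι) (x : X) :
    (⨆ y, X.basicOpen (coeffAt F h t i y)) ⊓ F.U x = X.basicOpen (coeffAt F h t i x) := by
  apply le_antisymm
  · rw [iSup_inf_eq]
    exact iSup_le fun y => (basicOpen_coeffAt_inf F h t i y x).le.trans inf_le_left
  · exact le_inf (le_iSup (fun y => X.basicOpen (coeffAt F h t i y)) x) (X.basicOpen_le _)

/-- A point `p` lies in `X_{t_i}` iff it lies in `X_{coeffAt i p}` (test in the generator at `p`
itself). [cite: Hartshorne1977, II proof of Thm. 7.1] -/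
theorem mem_iSup_basicOpen_coeffAt_iff (i : ι) (p : X) :
    p ∈ ⨆ y, X.basicOpen (coeffAt F h t i y) ↔ p ∈ X.basicOpen (coeffAt F h t i p) := by
  constructor
  · intro hp
    have : p ∈ (⨆ y, X.basicOpen (coeffAt F h t i y)) ⊓ F.U p := ⟨hp, F.mem p⟩
    rwa [iSup_basicOpen_coeffAt_inf] at this
  · intro hp
    exact Opens.mem_iSup.mpr ⟨p, hp⟩

/-- **Cover criterion**: the non-vanishing loci of the coefficients cover `X` iff at every point
`p` some `t_i` has a unit coefficient in the generator at `p` ("the `t_i` generate `E`";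
the hypothesis of `GeneratingSections.ofCocycleSections`). [cite: Hartshorne1977, II Thm. 7.1] -/
theorem iSup_basicOpen_coeffAt_eq_top_iff :
    ⨆ i, ⨆ y, X.basicOpen (coeffAt F h t i y) = ⊤ ↔
      ∀ p : X, ∃ i, p ∈ X.basicOpen (coeffAt F h t i p) := by
  constructor
  · intro htop p
    have hp : p ∈ (⨆ i, ⨆ y, X.basicOpen (coeffAt F h t i y)) := by rw [htop]; trivial
    obtain ⟨i, hi⟩ := Opens.mem_iSup.mp hp
    exact ⟨i, (mem_iSup_basicOpen_coeffAt_iff F h t i p).mp hi⟩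
  · intro hgen
    refine top_le_iff.mp fun p _ => ?_
    obtain ⟨i, hi⟩ := hgen p
    exact Opens.mem_iSup.mpr ⟨i, Opens.mem_iSup.mpr ⟨p, hi⟩⟩

end GeneratingSections

end Literature.AlgebraicGeometry.Motives
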